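import Summits.MatrixMultiplication.MatrixMultiplication.Theorems.SaturationLadderGaugeConeClasses
import Summits.MatrixMultiplication.MatrixMultiplication.Theorems.SaturationLadderUniform108
import HarnessLib

/-!
# SaturationLadder — Kernel XXXI: the in-class EXHAUSTION statement (the grade map's last column, by name)

Support for the deciding crux `SubexpSaturation` (h₁, item 25909) of `Theses/SaturationLadder.lean`
(cell `decomp-mm`, lens «grading / quantitative ladder», gen 58; critic g20 ASK (2)).  NEGATIVE-IN-CLASS /
INSTRUMENT, not currency: nothing here is a new rung.  No new hypotheses, no definitions, no `sorry`.

THE CRUX in clause currency: `clause(c) :≡ ∃ t₀ < 1, ∀ t ∈ [t₀,1), ∃ r ∈ [1, e^{c/(1−t)}], ω(1,t,r) ≤ 1 + r`;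
`SubexpSaturation = ∀ c > 0, clause(c)`; the uniform rung is `U(C) :≡ clause(C)` with `t₀ = 0`.  The class
ceiling is `c₂ = (5 log(5/4) + 3 log 2)/3 = 1.0650531…`.  The typed proxy for «a certificate of the tree's
classes» is membership of the thin format `(1,t,r)` in a GAUGE CONE
`G_{λ,μ}(1,t,r) :≡ λ·t/(1−t) ≤ log((1+r)/t) + μ` (`Theorems/SaturationLadderGaugeCone.lean`): every cone is closed
under Kronecker sums, scalings, exact and small-defect single-base transfers (`gauge_add`, `gauge_smul`,
`gauge_transfer`, `gauge_of_smallDefect`), and for every `0 < c < c₂` ONE cone of slope `(c+c₂)/2` contains every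
STAGE-2 twin design of positive thinness, the X-perfect catalogue and the near-square family
(`…GaugeConeClasses.twinClass_gauge`, `xPerfect_gauge`, `nearSquare_gauge`, `treeClasses_constant`).

THE GRADE MAP after gen 58 (`grade_map`, one statement; each column a theorem BY NAME):

| rate | eventual `clause` | uniform `U` | source |
|---|---|---|---|
| `C > c₂` | PROVED, onset `max(11/12, 1 − 81(C−c₂)/(80+162(C−c₂)))` | — | `…ExplicitCeilingClause.clause_explicit_onset` (XXIX) |
| `C ≥ 27/25` | PROVED | PROVED (`t₀ = 0`) | `…Uniform108.uniformClause_27_25` (XXX) |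
| `0 < c < c₂` | NOT from any cone of slope `> c` — in particular not from the slope-`(c+c₂)/2` cone holding every class of the tree | same | §1 below + `…GaugeConeClasses` |
| `c = c₂` | undecided AS A THEOREM in class (numerically: the real stage-2 optimum at level `j` has defect `c₂ + 0.10/j > c₂` for every `j ≥ 21`, below `c₂` only for `j ≤ 20`, i.e. `t ≤ 0.925`; cell instrument `gen58/num/dminf.py`) | same | instrument only |
| open content of h₁ | `∀ c ∈ (0, c₂], clause(c)` (`…GaugeConeClasses.subexpSaturation_iff_clause_le_classCeiling`) ⟺ exact thin formats of cofinal thinness OUTSIDE every cone of positive slope (§2, `subexpSaturation_iff_exits_cones`) | | §2 |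

MAIN RESULTS.
* §1 `cone_no_eventual_clause` / `cone_no_uniform_rung`: for `0 < c < λ` and EVERY level `μ`, the members of
  `G_{λ,μ}` witness neither `clause(c)` nor `U(c)` (from `…GaugeCone.gaugeClass_excludes_subexp_witness`);
  `twinClass_no_clause`: the instance `λ = (c+c₂)/2` with the stage-2 twin class (hypotheses of
  `…TwinExact.omegaRect_one_tw_exact` verbatim) inside the cone.
* §2 `clause_witness_exits_cone`, `subexpSaturation_exits_every_cone`, **`subexpSaturation_iff_exits_cones`**: a
  proof of `clause(c)` must exhibit, beyond every thinness, exact formats outside every cone of slope `> c`; and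
  h₁ holds iff for every slope `λ > 0` the exact thin formats leave `G_{λ,0}` cofinally in `t` — the typed form
  of the cell tag IDEA-NEEDED («a certificate class of gauge slope 0»; every catalogued class has slope `c₂`).
* §3 `grade_map`: the table above as one conjunction.

HONEST LABEL.  This file closes nothing and moves no constant; it records, by name, that inside the tree's
certificate classes the ladder is exhausted on BOTH graded currencies strictly below `c₂`, that the two positive
columns stand where Kernels XXIX/XXX put them, and what the open content `(0, c₂]` of h₁ demands of a new class.
The boundary grade `c = c₂` is NOT decided here (see the table).

References: D. Coppersmith, S. Winograd, J. Symbolic Comput. 9 (1990) §§6, 8 (key `CoppersmithWinograd1990`);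
J. Alman, R. Duan, V. Vassilevska Williams, Y. Xu, Z. Xu, R. Zhou, SODA 2025, Thm 3.2, §3.4 (key
`AlmanDuanVassilevskaWilliamsXuXuZhou2025`); G. Lotti, F. Romani, Theoret. Comput. Sci. 23 (1983) §1 (key
`LottiRomani1983`); M. Christandl, F. Le Gall, V. Lysikov, J. Zuiddam, «Barriers for rectangular matrix
multiplication» (2020), Thm 3.10 (key `ChristandlLeGallLysikovZuiddam2020`).
-/

set_option linter.dupNamespace false
-- (single-conjunct summit: the namespace repeats `MatrixMultiplication`)

noncomputable section

namespace Summit.MatrixMultiplication.MatrixMultiplication.Theorems.SaturationLadderInClassExhaustion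

open Literature.Computability.AlgebraicComplexity
open Summit.MatrixMultiplication.MatrixMultiplication.Theses.SaturationLadder (SubexpSaturation)
open Summit.MatrixMultiplication.MatrixMultiplication.Theorems.SaturationLadderGaugeCone
  (gaugeClass_excludes_subexp_witness)
open Summit.MatrixMultiplication.MatrixMultiplication.Theorems.SaturationLadderGaugeConeClasses
  (twinClass_gauge classCeiling_pos subexpSaturation_iff_clause_le_classCeiling)
open Summit.MatrixMultiplication.MatrixMultiplication.Theorems.SaturationLadderExplicitCeilingClause
  (clause_explicit_onset)
open Summit.MatrixMultiplication.MatrixMultiplication.Theorems.SaturationLadderUniform108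
  (uniformClause_27_25)
open Summit.MatrixMultiplication.MatrixMultiplication.Theorems.SaturationLadderUniformDefect
  (uniformClause_mono)

/-! ## §1 No cone of slope `> c` witnesses `clause(c)` or `U(c)` -/

/-- **No eventual clause from a cone.**  For `0 < c < λ` and every level `μ`: there is NO onset `t₁ < 1`
beyond which every `t` has a member `(1,t,r)` of `G_{λ,μ}` with `1 ≤ r ≤ e^{c/(1−t)}` — the cone cannot
certify `clause(c)`, whatever its level. [cite: CoppersmithWinograd1990, §8 (pp. 268–269)]
[cite: ChristandlLeGallLysikovZuiddam2020, Thm. 3.10] -/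
theorem cone_no_eventual_clause (lam μ c : ℝ) (hc : 0 < c) (hcl : c < lam) :
    ¬ ∃ t₁ : ℝ, t₁ < 1 ∧ ∀ t : ℝ, t₁ ≤ t → t < 1 → ∃ r : ℝ, 1 ≤ r ∧ r ≤ Real.exp (c / (1 - t)) ∧
        lam * (t / (1 - t)) ≤ Real.log ((1 + r) / t) + μ := by
  rintro ⟨t₁, ht₁, h⟩
  obtain ⟨t₀, ht₀, hex⟩ := gaugeClass_excludes_subexp_witness lam μ c hc hcl
  obtain ⟨r, hr1, hrle, hG⟩ := h (max t₀ t₁) (le_max_right _ _) (max_lt ht₀ ht₁)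
  have := hex (max t₀ t₁) r (le_max_left _ _) (max_lt ht₀ ht₁) (by linarith) hG
  linarith

/-- **No uniform rung from a cone.**  For `0 < c < λ` and every `μ`: the members of `G_{λ,μ}` do not certify
`U(c)` (`∀ t ∈ [0,1) ∃ r ∈ [1, e^{c/(1−t)}]` in the cone). [cite: CoppersmithWinograd1990, §8 (pp. 268–269)] -/
theorem cone_no_uniform_rung (lam μ c : ℝ) (hc : 0 < c) (hcl : c < lam) :
    ¬ ∀ t : ℝ, 0 ≤ t → t < 1 → ∃ r : ℝ, 1 ≤ r ∧ r ≤ Real.exp (c / (1 - t)) ∧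
        lam * (t / (1 - t)) ≤ Real.log ((1 + r) / t) + μ := fun h =>
  cone_no_eventual_clause lam μ c hc hcl ⟨0, one_pos, fun t ht0 ht1 => h t ht0 ht1⟩

/-- **The stage-2 twin class certifies no `clause(c)` and no `U(c)` for `c < c₂`.**  For every `0 < c < c₂`
there is a level `μ ≥ 0` such that (i) every STAGE-2 twin design of positive thinness (hypotheses of
`…TwinExact.omegaRect_one_tw_exact` verbatim) lies in the cone `G_{(c+c₂)/2, μ}`, while (ii) that cone
certifies neither the eventual clause nor the uniform rung at rate `c`.  (The X-perfect catalogue and the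
near-square family lie in the same cone for `μ ≥ 1 − log 2`: `…GaugeConeClasses.xPerfect_gauge`,
`nearSquare_gauge`.) [cite: CoppersmithWinograd1990, §8 (pp. 268–269)]
[cite: AlmanDuanVassilevskaWilliamsXuXuZhou2025, Thm. 3.2 and §3.4] -/
theorem twinClass_no_clause (c : ℝ) (hc : 0 < c) (hc₂ : c < (5 * Real.log (5 / 4) + 3 * Real.log 2) / 3) :
    ∃ μ : ℝ, 0 ≤ μ ∧
      (∀ (j n₁ n₂ n₃ n₄ n₅ n₆ : ℕ), 0 < n₆ → n₁ + n₄ + n₅ = 2 * n₆ → n₂ + n₃ = 2 ^ (j + 1) * n₆ →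
          shannonEntropy ![((n₁ : ℝ) + n₄ + n₅) / (n₁ + n₂ + n₃ + n₄ + n₅ + n₆ : ℕ),
                ((n₂ : ℝ) + n₃) / (n₁ + n₂ + n₃ + n₄ + n₅ + n₆ : ℕ),
                (n₆ : ℝ) / (n₁ + n₂ + n₃ + n₄ + n₅ + n₆ : ℕ)] ≤
              shannonEntropy ![((n₂ : ℝ) + n₄ + n₆) / (n₁ + n₂ + n₃ + n₄ + n₅ + n₆ : ℕ),
                ((n₁ : ℝ) + n₃) / (n₁ + n₂ + n₃ + n₄ + n₅ + n₆ : ℕ),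
                (n₅ : ℝ) / (n₁ + n₂ + n₃ + n₄ + n₅ + n₆ : ℕ)] →
          shannonEntropy ![((n₁ : ℝ) + n₄ + n₅) / (n₁ + n₂ + n₃ + n₄ + n₅ + n₆ : ℕ),
                ((n₂ : ℝ) + n₃) / (n₁ + n₂ + n₃ + n₄ + n₅ + n₆ : ℕ),
                (n₆ : ℝ) / (n₁ + n₂ + n₃ + n₄ + n₅ + n₆ : ℕ)] ≤
              shannonEntropy ![((n₃ : ℝ) + n₅ + n₆) / (n₁ + n₂ + n₃ + n₄ + n₅ + n₆ : ℕ),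
                ((n₁ : ℝ) + n₂) / (n₁ + n₂ + n₃ + n₄ + n₅ + n₆ : ℕ),
                (n₄ : ℝ) / (n₁ + n₂ + n₃ + n₄ + n₅ + n₆ : ℕ)] →
          0 < (j : ℝ) * n₁ / (((j : ℝ) + 1) * n₃ + n₅) →
          (j : ℝ) * n₁ / (((j : ℝ) + 1) * n₃ + n₅) < 1 ∧
            ((c + (5 * Real.log (5 / 4) + 3 * Real.log 2) / 3) / 2) *
                ((j : ℝ) * n₁ / (((j : ℝ) + 1) * n₃ + n₅) / (1 - (j : ℝ) * n₁ / (((j : ℝ) + 1) * n₃ + n₅))) ≤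
              Real.log ((1 + (((j : ℝ) + 1) * n₂ + n₁ + n₄) / (((j : ℝ) + 1) * n₃ + n₅)) /
                  ((j : ℝ) * n₁ / (((j : ℝ) + 1) * n₃ + n₅))) + μ) ∧
      (¬ ∃ t₁ : ℝ, t₁ < 1 ∧ ∀ t : ℝ, t₁ ≤ t → t < 1 → ∃ r : ℝ, 1 ≤ r ∧ r ≤ Real.exp (c / (1 - t)) ∧
          ((c + (5 * Real.log (5 / 4) + 3 * Real.log 2) / 3) / 2) * (t / (1 - t)) ≤
            Real.log ((1 + r) / t) + μ) ∧
      (¬ ∀ t : ℝ, 0 ≤ t → t < 1 → ∃ r : ℝ, 1 ≤ r ∧ r ≤ Real.exp (c / (1 - t)) ∧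
          ((c + (5 * Real.log (5 / 4) + 3 * Real.log 2) / 3) / 2) * (t / (1 - t)) ≤
            Real.log ((1 + r) / t) + μ) := by
  have hε : 0 < ((5 * Real.log (5 / 4) + 3 * Real.log 2) / 3 - c) / 2 := by linarith
  have hεc : ((5 * Real.log (5 / 4) + 3 * Real.log 2) / 3 - c) / 2 <
      (5 * Real.log (5 / 4) + 3 * Real.log 2) / 3 := by linarith
  obtain ⟨μ, hμ, hT⟩ := twinClass_gauge _ hε hεc
  have hlam : c < (c + (5 * Real.log (5 / 4) + 3 * Real.log 2) / 3) / 2 := by linarith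
  refine ⟨μ, hμ, ?_, cone_no_eventual_clause _ μ c hc hlam, cone_no_uniform_rung _ μ c hc hlam⟩
  intro j n₁ n₂ n₃ n₄ n₅ n₆ hn₆ hz₁ hz₂ hX hY ht0
  obtain ⟨ht1, hG⟩ := hT j n₁ n₂ n₃ n₄ n₅ n₆ hn₆ hz₁ hz₂ hX hY ht0
  refine ⟨ht1, ?_⟩
  have e : (5 * Real.log (5 / 4) + 3 * Real.log 2) / 3 -
      ((5 * Real.log (5 / 4) + 3 * Real.log 2) / 3 - c) / 2 =
      (c + (5 * Real.log (5 / 4) + 3 * Real.log 2) / 3) / 2 := by ring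
  rw [e] at hG
  exact hG

/-! ## §2 What a proof of the crux must exhibit: exact formats outside every cone of positive slope -/

/-- **A `clause(c)` witness family leaves every cone of slope `> c`.**  If `clause(c)` holds then beyond some
thinness every `t` carries an exact format `(1,t,r)`, `1 ≤ r ≤ e^{c/(1−t)}`, OUTSIDE `G_{λ,μ}` — for every
`λ > c` and every `μ`. [cite: CoppersmithWinograd1990, §8 (pp. 268–269)] [cite: LottiRomani1983, §1 (p. 173)] -/
theorem clause_witness_exits_cone (lam μ c : ℝ) (hc : 0 < c) (hcl : c < lam)
    (hclause : ∃ t₁ : ℝ, t₁ < 1 ∧ ∀ t : ℝ, t₁ ≤ t → t < 1 →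
      ∃ r : ℝ, 1 ≤ r ∧ r ≤ Real.exp (c / (1 - t)) ∧ omegaRect ℂ 1 t r ≤ 1 + r) :
    ∃ t₀ : ℝ, t₀ < 1 ∧ ∀ t : ℝ, t₀ ≤ t → t < 1 →
      ∃ r : ℝ, 1 ≤ r ∧ r ≤ Real.exp (c / (1 - t)) ∧ omegaRect ℂ 1 t r ≤ 1 + r ∧
        ¬ (lam * (t / (1 - t)) ≤ Real.log ((1 + r) / t) + μ) := by
  obtain ⟨t₁, ht₁, h⟩ := hclause
  obtain ⟨t₀, ht₀, hex⟩ := gaugeClass_excludes_subexp_witness lam μ c hc hcl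
  refine ⟨max t₀ t₁, max_lt ht₀ ht₁, fun t ht htl => ?_⟩
  obtain ⟨r, hr1, hrle, hω⟩ := h t (le_trans (le_max_right _ _) ht) htl
  refine ⟨r, hr1, hrle, hω, fun hG => ?_⟩
  have := hex t r (le_trans (le_max_left _ _) ht) htl (by linarith) hG
  linarith

/-- **`SubexpSaturation` forces exact formats outside EVERY cone of positive slope**, at every level, with
cofinal thinness (rate `λ/2` inside the cone of slope `λ`). [cite: CoppersmithWinograd1990, §8 (pp. 268–269)] -/
theorem subexpSaturation_exits_every_cone (hS : SubexpSaturation) (lam μ : ℝ) (hlam : 0 < lam) :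
    ∃ t₀ : ℝ, t₀ < 1 ∧ ∀ t : ℝ, t₀ ≤ t → t < 1 →
      ∃ r : ℝ, 1 ≤ r ∧ r ≤ Real.exp ((lam / 2) / (1 - t)) ∧ omegaRect ℂ 1 t r ≤ 1 + r ∧
        ¬ (lam * (t / (1 - t)) ≤ Real.log ((1 + r) / t) + μ) :=
  clause_witness_exits_cone lam μ (lam / 2) (by linarith) (by linarith) (hS (lam / 2) (by linarith))

/-- **h₁ in cone language (an equal-strength reading, not a piece).**  `SubexpSaturation` holds iff for every
slope `λ > 0` there is a thinness beyond which every `t` carries an exact format `(1,t,r)`, `r ≥ 1`, outside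
the level-0 cone `G_{λ,0}`.  (`⇐`: outside `G_{λ,0}` means `log((1+r)/t) < λt/(1−t)`, and for `1/2 ≤ t < 1`
this gives `log r ≤ log((1+r)/t) < λ/(1−t)`.)  Every catalogued class of the tree has slope `c₂`
(`…GaugeConeClasses`); the crux asks for slope `0`. [cite: CoppersmithWinograd1990, §8 (pp. 268–269)]
[cite: LottiRomani1983, §1 (p. 173)] -/
theorem subexpSaturation_iff_exits_cones :
    SubexpSaturation ↔ ∀ lam : ℝ, 0 < lam → ∃ t₀ : ℝ, t₀ < 1 ∧ ∀ t : ℝ, t₀ ≤ t → t < 1 →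
      ∃ r : ℝ, 1 ≤ r ∧ omegaRect ℂ 1 t r ≤ 1 + r ∧ ¬ (lam * (t / (1 - t)) ≤ Real.log ((1 + r) / t)) := by
  constructor
  · intro hS lam hlam
    obtain ⟨t₀, ht₀, h⟩ := subexpSaturation_exits_every_cone hS lam 0 hlam
    refine ⟨t₀, ht₀, fun t ht htl => ?_⟩
    obtain ⟨r, hr1, -, hω, hG⟩ := h t ht htl
    exact ⟨r, hr1, hω, by simpa using hG⟩
  · intro h c hc
    obtain ⟨t₀, ht₀, hx⟩ := h c hc
    refine ⟨max (1 / 2) t₀, max_lt (by norm_num) ht₀, fun t ht htl => ?_⟩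
    have ht12 : 1 / 2 ≤ t := le_trans (le_max_left _ _) ht
    have ht0 : 0 < t := by linarith
    have hs : 0 < 1 - t := by linarith
    obtain ⟨r, hr1, hω, hG⟩ := hx t (le_trans (le_max_right _ _) ht) htl
    refine ⟨r, hr1, ?_, hω⟩
    have hr0 : 0 < r := by linarith
    have hlt : Real.log ((1 + r) / t) < c * (t / (1 - t)) := lt_of_not_ge hG
    -- `log r ≤ log((1+r)/t)` since `r·t ≤ r ≤ 1 + r`
    have h1 : Real.log r ≤ Real.log ((1 + r) / t) := by
      apply Real.log_le_log hr0
      rw [le_div_iff₀ ht0]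
      nlinarith
    -- `c·t/(1−t) ≤ c/(1−t)`
    have h2 : c * (t / (1 - t)) ≤ c / (1 - t) := by
      rw [mul_div_assoc', div_le_div_iff_of_pos_right hs]
      nlinarith
    calc r = Real.exp (Real.log r) := (Real.exp_log hr0).symm
      _ ≤ Real.exp (c / (1 - t)) := Real.exp_le_exp.2 (by linarith)

/-! ## §3 The grade map in one statement -/

/-- **THE GRADE MAP of the quantitative ladder after gen 58** (`c₂ = (5 log(5/4) + 3 log 2)/3`).
(i) EVENTUAL, PROVED: every `C > c₂`, onset `max(11/12, 1 − 81(C−c₂)/(80+162(C−c₂)))` (Kernel XXIX).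
(ii) UNIFORM, PROVED: every `C ≥ 27/25`, onset `0` (Kernel XXX).
(iii) EXCLUDED IN CLASS: for every `0 < c < c₂` and EVERY level `μ`, the cone of slope `(c+c₂)/2` — which at a
suitable level contains every stage-2 twin design, the X-perfect catalogue and the near-square family
(`twinClass_no_clause`, `…GaugeConeClasses.treeClasses_constant`) — certifies neither `clause(c)` nor `U(c)`.
(iv) OPEN CONTENT: `SubexpSaturation ⟺ ∀ c ∈ (0, c₂], clause(c)` ⟺ exact formats of cofinal thinness outside
every cone of positive slope.  The boundary grade `c = c₂` is not decided by this file.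
[cite: CoppersmithWinograd1990, §8 (pp. 268–269)] [cite: AlmanDuanVassilevskaWilliamsXuXuZhou2025, Thm. 3.2 and §3.4]
[cite: LottiRomani1983, §1 (p. 173)] -/
theorem grade_map :
    (∀ C : ℝ, (5 * Real.log (5 / 4) + 3 * Real.log 2) / 3 < C →
      ∃ t₀ : ℝ, t₀ = max (11 / 12) (1 - 81 * (C - (5 * Real.log (5 / 4) + 3 * Real.log 2) / 3) /
          (80 + 162 * (C - (5 * Real.log (5 / 4) + 3 * Real.log 2) / 3))) ∧ t₀ < 1 ∧
        ∀ t : ℝ, t₀ ≤ t → t < 1 →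
          ∃ r : ℝ, 1 ≤ r ∧ r ≤ Real.exp (C / (1 - t)) ∧ omegaRect ℂ 1 t r ≤ 1 + r) ∧
    (∀ C : ℝ, 27 / 25 ≤ C → ∀ t : ℝ, 0 ≤ t → t < 1 →
        ∃ r : ℝ, 1 ≤ r ∧ r ≤ Real.exp (C / (1 - t)) ∧ omegaRect ℂ 1 t r ≤ 1 + r) ∧
    (∀ c : ℝ, 0 < c → c < (5 * Real.log (5 / 4) + 3 * Real.log 2) / 3 → ∀ μ : ℝ,
      (¬ ∃ t₁ : ℝ, t₁ < 1 ∧ ∀ t : ℝ, t₁ ≤ t → t < 1 → ∃ r : ℝ, 1 ≤ r ∧ r ≤ Real.exp (c / (1 - t)) ∧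
          ((c + (5 * Real.log (5 / 4) + 3 * Real.log 2) / 3) / 2) * (t / (1 - t)) ≤
            Real.log ((1 + r) / t) + μ) ∧
      (¬ ∀ t : ℝ, 0 ≤ t → t < 1 → ∃ r : ℝ, 1 ≤ r ∧ r ≤ Real.exp (c / (1 - t)) ∧
          ((c + (5 * Real.log (5 / 4) + 3 * Real.log 2) / 3) / 2) * (t / (1 - t)) ≤
            Real.log ((1 + r) / t) + μ)) ∧
    (SubexpSaturation ↔ ∀ c : ℝ, 0 < c → c ≤ (5 * Real.log (5 / 4) + 3 * Real.log 2) / 3 →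
      ∃ t₀ : ℝ, t₀ < 1 ∧ ∀ t : ℝ, t₀ ≤ t → t < 1 →
        ∃ r : ℝ, 1 ≤ r ∧ r ≤ Real.exp (c / (1 - t)) ∧ omegaRect ℂ 1 t r ≤ 1 + r) ∧
    (SubexpSaturation ↔ ∀ lam : ℝ, 0 < lam → ∃ t₀ : ℝ, t₀ < 1 ∧ ∀ t : ℝ, t₀ ≤ t → t < 1 →
      ∃ r : ℝ, 1 ≤ r ∧ omegaRect ℂ 1 t r ≤ 1 + r ∧ ¬ (lam * (t / (1 - t)) ≤ Real.log ((1 + r) / t))) := by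
  refine ⟨fun C hC => clause_explicit_onset hC, fun C hC => uniformClause_mono hC uniformClause_27_25,
    fun c hc hc₂ μ => ?_, subexpSaturation_iff_clause_le_classCeiling, subexpSaturation_iff_exits_cones⟩
  have hlam : c < (c + (5 * Real.log (5 / 4) + 3 * Real.log 2) / 3) / 2 := by linarith
  exact ⟨cone_no_eventual_clause _ μ c hc hlam, cone_no_uniform_rung _ μ c hc hlam⟩

end Summit.MatrixMultiplication.MatrixMultiplication.Theorems.SaturationLadderInClassExhaustion

end
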